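import Summits.QuantumFields.YangMills.Theorems.SwapVirialDeficitSectorLaplaceTrStiffness
import Summits.QuantumFields.YangMills.Theorems.SwapVirialDeficitSectorLaplaceBTubeCapStiffThresholds
import Summits.QuantumFields.YangMills.Theorems.SwapVirialDeficitSectorLaplaceBTubeHubCot
import HarnessLib

/-!
# STUB (S-001-good) OF SKELETON ➎ — ★★★ CLOSED BY NAME: `h001_good` = `stub_h001_good` VERBATIM (the good sign patterns of sector 001 are chart-measure stiff with plain `κ_L`)
# (free-hands support of ⟨stmt-QuantumFields-24197⟩ `SwapVirialDeficit.SwapGluedStiffness`; cell ym-idea-1; assembler fcl-p3 g48)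

* §1 READING: `lintegral_tr_eq_hubCot` ∕ `integral_tr_exp_eq_hubCot` ∕ `integral_tr_action_eq_hubCot` — the WHOLE-chart integrals of `g(F̂₁(a, ε, η))` against
  `chartMeasure L` equal `coneConst·π·∫ g(F̂₁(hubAt δ 1, ε, η)) dμ_B(δ, η)` (✓`trGnoDeficit_eq_hubCot` off the cone-null real axis, ✓`lintegral_chartMeasure_hubCot_muB`);
* §2 THRESHOLDS: `tr_threshold_data` — the radius `R = λ₁∕(8(m+8)·1136016L⁴)` and ONE polynomial ceiling `G = (8·10¹⁵ + 12|log(coneConst³∕64)|)·L¹⁸` over `λ₁⁻¹`, `m+8`,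
  `A₃`, `R⁻¹` and the tail budget, feeding ✓`bTube_threshold_arith` ∕ ✓`bTube_habs` (g48's B-tube arithmetic is generic in `λ`);
* §3 ★★★ `h001_good` — `∃ K > 0, ∃ q, ∀ L b, K·L^q ≤ b → ∀ ε, GoodSign ε → (9L⁴ − 3∕2 + 1∕8)·∫ e^{−bF̂₁} d(chartMeasure L) ≤ b·∫ F̂₁e^{−bF̂₁} d(chartMeasure L)` with
  `K = (60000·290·C⁵)⁴`, `C = 8·10¹⁵ + 12|log(coneConst³∕64)|`, `q = 376` (✓`tr_stiff` in the letters, read back by §1).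

HONEST LABEL: closes the skeleton stub `stub_h001_good` only; (S-core-tip), (S-end-G) and hence ⟨24197⟩ ∕ ⟨24194⟩ remain OPEN; item of record ⟨24085⟩ SubOctaveBounded aside ∕
untouched; the Yang–Mills mass gap is NOT proved; no summit is proved by a line.  THEOREMS ONLY (0 `def`, 0 `sorry`), standard axioms, no instances.  Seat ym-line-fcl-p3 g48
(cell ym-idea-1, free hands), `--supports stmt-QuantumFields-24197`.  References: [cite: Luscher1983, §2]; [cite: Griffiths1964]; [folklore].
-/

set_option autoImplicit false
set_option synthInstance.maxSize 1024

noncomputable section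

open MeasureTheory Quaternion Set Metric Module
open scoped Quaternion BigOperators ENNReal InnerProductSpace
open Literature.MathematicalPhysics.QuantumLattice
open Literature.MathematicalPhysics.QuantumFieldTheory hiding SU2
open Summit.QuantumFields.YangMills.Theorems.SwapTwistDeficit.ToronLog

namespace Summit.QuantumFields.YangMills.Theorems.SwapVirialDeficit.SectorLaplace

open Summit.QuantumFields.YangMills.Theorems.FemtoTransferGap
open Summit.QuantumFields.YangMills.Theorems.FemtoTransferGap.TT
open Summit.QuantumFields.YangMills.Theorems.VirialFluxGap.RingDeficit
open Summit.QuantumFields.YangMills.Theorems.SwapVirialDeficit.SwapRing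
open Summit.QuantumFields.YangMills.Theorems.SwapVirialDeficit.BlowUpRing

variable {L : ℕ} [NeZero L]

/-! ## §1 Reading the whole-chart 001 integrals in the letters `(δ, η)` -/

/-- ★★ **THE WHOLE-CHART 001 INTEGRALS IN THE LETTERS `(δ, η)`**: for every measurable `g : ℝ → ℝ≥0∞` and signs `ε`,
`∫⁻ g(F̂₁(a, ε, η)) d(chartMeasure L) = coneConst·π · ∫⁻ g(F̂₁(hubAt δ 1, ε, η)) dμ_B(δ, η)` (✓`trGnoDeficit_eq_hubCot` off the cone-null real axis, then
✓`lintegral_chartMeasure_hubCot_muB`). [folklore] -/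
theorem lintegral_tr_eq_hubCot (ε : GnoSign L) (g : ℝ → ℝ≥0∞) (hg : Measurable g) :
    ∫⁻ x, g (trGnoDeficit uJ z₁ (sectorChar z₁) x.1 ε x.2) ∂(chartMeasure L) =
      ENNReal.ofReal (coneConst * Real.pi) *
        ∫⁻ p, g (trGnoDeficit uJ z₁ (sectorChar z₁) (hubAt p.1 1) ε p.2)
          ∂((volume : Measure (ℝ × GnoCoord L)).withDensity fun p => ENNReal.ofReal (((1 + p.1 ^ 2)⁻¹) ^ 2 * gnoDensity p.2)) := by
  set H : ℝ × GnoCoord L → ℝ≥0∞ := fun p => g (trGnoDeficit uJ z₁ (sectorChar z₁) (hubAt p.1 1) ε p.2) with hHdef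
  have hHm : Measurable H := hg.comp (contDiff_trDeficit (n := 0) ε).continuous.measurable
  have hae : (fun x : ℍ × GnoCoord L => g (trGnoDeficit uJ z₁ (sectorChar z₁) x.1 ε x.2)) =ᵐ[chartMeasure L]
      fun x : ℍ × GnoCoord L => H (x.1.re / ‖x.1.im‖, x.2) := by
    filter_upwards [ae_im_ne_zero_chartMeasure (L := L)] with x him
    rw [hHdef, trGnoDeficit_eq_hubCot uJ z₁ (sectorChar z₁) him]
  rw [lintegral_congr_ae hae, lintegral_chartMeasure_hubCot_muB H hHm]

/-- ★ The whole-chart 001 partition function in the letters. [folklore] -/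
theorem integral_tr_exp_eq_hubCot (ε : GnoSign L) (b : ℝ) :
    ∫ x, Real.exp (-(b * trGnoDeficit uJ z₁ (sectorChar z₁) x.1 ε x.2)) ∂(chartMeasure L) =
      coneConst * Real.pi *
        ∫ p, Real.exp (-(b * trGnoDeficit uJ z₁ (sectorChar z₁) (hubAt p.1 1) ε p.2))
          ∂((volume : Measure (ℝ × GnoCoord L)).withDensity fun p => ENNReal.ofReal (((1 + p.1 ^ 2)⁻¹) ^ 2 * gnoDensity p.2)) := by
  -- (no `MeasurableSpace ℍ` synthesis: the σ-algebra is carried by ✓`measurable_trGnoDeficit_uncurry` ∕ `chartMeasure L`)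
  have hm1 := ((measurable_trGnoDeficit_uncurry uJ z₁ (sectorChar z₁) ε).const_mul b).neg.exp
  have hm2 : Measurable fun p : ℝ × GnoCoord L => Real.exp (-(b * trGnoDeficit uJ z₁ (sectorChar z₁) (hubAt p.1 1) ε p.2)) :=
    (((contDiff_trDeficit (n := 0) ε).continuous.measurable).const_mul b).neg.exp
  rw [integral_eq_lintegral_of_nonneg_ae (f := fun x : ℍ × GnoCoord L => Real.exp (-(b * trGnoDeficit uJ z₁ (sectorChar z₁) x.1 ε x.2)))
      (Filter.Eventually.of_forall fun x => (Real.exp_pos _).le) hm1.aestronglyMeasurable,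
    integral_eq_lintegral_of_nonneg_ae (Filter.Eventually.of_forall fun x => (Real.exp_pos _).le) hm2.aestronglyMeasurable]
  have h := lintegral_tr_eq_hubCot (L := L) ε (fun t => ENNReal.ofReal (Real.exp (-(b * t)))) (by fun_prop)
  rw [h, ENNReal.toReal_mul, ENNReal.toReal_ofReal (mul_pos coneConst_pos Real.pi_pos).le]

/-- ★ The whole-chart 001 action integral in the letters. [folklore] -/
theorem integral_tr_action_eq_hubCot (ε : GnoSign L) (b : ℝ) :
    ∫ x, trGnoDeficit uJ z₁ (sectorChar z₁) x.1 ε x.2 * Real.exp (-(b * trGnoDeficit uJ z₁ (sectorChar z₁) x.1 ε x.2)) ∂(chartMeasure L) =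
      coneConst * Real.pi *
        ∫ p, trGnoDeficit uJ z₁ (sectorChar z₁) (hubAt p.1 1) ε p.2 * Real.exp (-(b * trGnoDeficit uJ z₁ (sectorChar z₁) (hubAt p.1 1) ε p.2))
          ∂((volume : Measure (ℝ × GnoCoord L)).withDensity fun p => ENNReal.ofReal (((1 + p.1 ^ 2)⁻¹) ^ 2 * gnoDensity p.2)) := by
  have hF1 := measurable_trGnoDeficit_uncurry uJ z₁ (sectorChar z₁) ε
  have hF2 : Measurable fun p : ℝ × GnoCoord L => trGnoDeficit uJ z₁ (sectorChar z₁) (hubAt p.1 1) ε p.2 := (contDiff_trDeficit (n := 0) ε).continuous.measurable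
  have hm1 := hF1.mul (hF1.const_mul b).neg.exp
  have hm2 : Measurable fun p : ℝ × GnoCoord L =>
      trGnoDeficit uJ z₁ (sectorChar z₁) (hubAt p.1 1) ε p.2 * Real.exp (-(b * trGnoDeficit uJ z₁ (sectorChar z₁) (hubAt p.1 1) ε p.2)) :=
    hF2.mul (hF2.const_mul b).neg.exp
  rw [integral_eq_lintegral_of_nonneg_ae
      (f := fun x : ℍ × GnoCoord L => trGnoDeficit uJ z₁ (sectorChar z₁) x.1 ε x.2 * Real.exp (-(b * trGnoDeficit uJ z₁ (sectorChar z₁) x.1 ε x.2)))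
      (Filter.Eventually.of_forall fun x => mul_nonneg (trGnoDeficit_nonneg _ _ _ _ _ _) (Real.exp_pos _).le) hm1.aestronglyMeasurable,
    integral_eq_lintegral_of_nonneg_ae (Filter.Eventually.of_forall fun x => mul_nonneg (trGnoDeficit_nonneg _ _ _ _ _ _) (Real.exp_pos _).le)
      hm2.aestronglyMeasurable]
  have h := lintegral_tr_eq_hubCot (L := L) ε (fun t => ENNReal.ofReal (t * Real.exp (-(b * t)))) (by fun_prop)
  rw [h, ENNReal.toReal_mul, ENNReal.toReal_ofReal (mul_pos coneConst_pos Real.pi_pos).le]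

/-! ## §2 Threshold data -/

/-- `1 + |Fol L| ≤ 6L⁴` (`|Fol L| = 6L⁴ − 3`). [folklore] -/
theorem one_add_card_fol_le : 1 + (Fintype.card (Fol L) : ℝ) ≤ 6 * (L : ℝ) ^ 4 := by
  have h := card_fol (L := L)
  have h1 : 1 ≤ L ^ 4 := Nat.one_le_pow _ _ (Nat.pos_of_ne_zero (NeZero.ne L))
  have h2 : (Fintype.card (Fol L) : ℝ) = 6 * (L : ℝ) ^ 4 - 3 := by
    rw [h]; push_cast [Nat.cast_sub (by omega : 3 ≤ 6 * L ^ 4)]; ring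
  rw [h2]; linarith

/-- ★ **THE 001 THRESHOLD DATA**: with `λ₁ = (5408(1+|Fol L|)L⁶)⁻¹`, `m₈ = m + 8`, `A₃ = 1136016L⁴`, the radius `R = λ₁∕(8m₈A₃)` and the tail budget
`Br = 2·(4(9L⁴+1) + (6 + |log(coneConst³∕64)| + 18L⁴ + 719712L⁸))`, the single ceiling `G = (8·10¹⁵ + 12|log(coneConst³∕64)|)·L¹⁸` dominates `λ₁⁻¹, m₈, A₃, R⁻¹, Br`,
and `R ≤ 1`, `A₃R ≤ λ₁∕(8m₈)`, `2R·R ≤ 1`. [folklore] -/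
theorem tr_threshold_data :
    ∃ R G : ℝ, 0 < R ∧ R ≤ 1 ∧
      1136016 * (L : ℝ) ^ 4 * R ≤ (5408 * (1 + (Fintype.card (Fol L) : ℝ)) * (L : ℝ) ^ 6)⁻¹ / (8 * ((finrank ℝ (GnoFibreB L) : ℝ) + 8)) ∧ 2 * R * R ≤ 1 ∧
      1 ≤ G ∧ ((5408 * (1 + (Fintype.card (Fol L) : ℝ)) * (L : ℝ) ^ 6)⁻¹)⁻¹ ≤ G ∧ (finrank ℝ (GnoFibreB L) : ℝ) + 8 ≤ G ∧ 1136016 * (L : ℝ) ^ 4 ≤ G ∧ R⁻¹ ≤ G ∧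
      2 * (4 * (9 * (L : ℝ) ^ 4 + 1) + (6 + |Real.log (coneConst ^ 3 / 64)| + 18 * (L : ℝ) ^ 4 + 719712 * (L : ℝ) ^ 8)) ≤ G ∧
      G ≤ (8000000000000000 + 12 * |Real.log (coneConst ^ 3 / 64)|) * (L : ℝ) ^ 18 := by
  have hL1 : (1 : ℝ) ≤ L := by exact_mod_cast NeZero.one_le
  have hL4 : (1 : ℝ) ≤ (L : ℝ) ^ 4 := one_le_pow₀ hL1
  have hL6 : (1 : ℝ) ≤ (L : ℝ) ^ 6 := one_le_pow₀ hL1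
  have hL8 : (1 : ℝ) ≤ (L : ℝ) ^ 8 := one_le_pow₀ hL1
  have hL18 : (1 : ℝ) ≤ (L : ℝ) ^ 18 := one_le_pow₀ hL1
  have hc := one_add_card_fol_le (L := L)
  have hc1 : (1 : ℝ) ≤ 1 + (Fintype.card (Fol L) : ℝ) := by have : (0 : ℝ) ≤ Fintype.card (Fol L) := Nat.cast_nonneg _; linarith
  have hm8 := finrankB_add_eight_le (L := L)
  have hm80 : (0 : ℝ) < (finrank ℝ (GnoFibreB L) : ℝ) + 8 := by positivity
  set lg : ℝ := |Real.log (coneConst ^ 3 / 64)| with hlg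
  have hlg0 : 0 ≤ lg := abs_nonneg _
  set c : ℝ := 1 + (Fintype.card (Fol L) : ℝ) with hcdef
  set m8 : ℝ := (finrank ℝ (GnoFibreB L) : ℝ) + 8 with hm8def
  set lam : ℝ := (5408 * c * (L : ℝ) ^ 6)⁻¹ with hlam
  have hlam0 : 0 < lam := by positivity
  have hlaminv : lam⁻¹ = 5408 * c * (L : ℝ) ^ 6 := by rw [hlam, inv_inv]
  have hlam1 : lam ≤ 1 := by
    rw [hlam, inv_le_one_iff₀]; right; nlinarith
  set A : ℝ := 1136016 * (L : ℝ) ^ 4 with hA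
  have hA1 : 1 ≤ A := by rw [hA]; nlinarith
  set R : ℝ := lam / (8 * m8 * A) with hR
  have hR0 : 0 < R := by positivity
  have hRle : R ≤ 1 / 64 := by
    rw [hR, div_le_div_iff₀ (by positivity) (by norm_num)]
    have : 64 ≤ 8 * m8 * A := by nlinarith [hm80]
    nlinarith
  have hR1 : R ≤ 1 := by linarith
  have hRinv : R⁻¹ = 8 * m8 * A / lam := by rw [hR, inv_div]
  set G : ℝ := (8000000000000000 + 12 * lg) * (L : ℝ) ^ 18 with hG
  have hG1 : (8000000000000000 : ℝ) * 1 ≤ G := by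
    rw [hG]; exact mul_le_mul (by linarith) hL18 (by norm_num) (by positivity)
  have h4_18 : (L : ℝ) ^ 4 ≤ (L : ℝ) ^ 18 := pow_le_pow_right₀ hL1 (by norm_num)
  have h8_18 : (L : ℝ) ^ 8 ≤ (L : ℝ) ^ 18 := pow_le_pow_right₀ hL1 (by norm_num)
  have h10_18 : (L : ℝ) ^ 10 ≤ (L : ℝ) ^ 18 := pow_le_pow_right₀ hL1 (by norm_num)
  have hlgL : lg ≤ lg * (L : ℝ) ^ 18 := le_mul_of_one_le_right hlg0 hL18
  have hlgL0 : 0 ≤ lg * (L : ℝ) ^ 18 := by positivity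
  have eG : G = 8000000000000000 * (L : ℝ) ^ 18 + 12 * (lg * (L : ℝ) ^ 18) := by rw [hG]; ring
  refine ⟨R, G, hR0, hR1, ?_, ?_, by linarith, ?_, ?_, ?_, ?_, ?_, le_rfl⟩
  · -- `A R = λ∕(8 m8)`
    have e : A * R = lam / (8 * m8) := by rw [hR]; field_simp
    rw [e]
  · nlinarith
  · -- `λ⁻¹ = 5408 c L⁶ ≤ 32448 L¹⁰ ≤ G`
    rw [hlaminv]
    have h1 : 5408 * c * (L : ℝ) ^ 6 ≤ 5408 * (6 * (L : ℝ) ^ 4) * (L : ℝ) ^ 6 := by gcongr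
    have e1 : 5408 * (6 * (L : ℝ) ^ 4) * (L : ℝ) ^ 6 = 32448 * (L : ℝ) ^ 10 := by ring
    rw [eG]; linarith
  · -- `m8 ≤ 25L⁴ ≤ G`
    rw [eG]; linarith
  · -- `A = 1136016L⁴ ≤ G`
    rw [hA, eG]; linarith
  · -- `R⁻¹ = 8 m8 A∕λ = 8 m8 A · 5408 c L⁶ ≤ 7.4·10¹² L¹⁸ ≤ G`
    rw [hRinv, div_eq_mul_inv, hlaminv]
    have hm8_0 : 0 ≤ m8 := hm80.le
    have h1 : 8 * m8 * A * (5408 * c * (L : ℝ) ^ 6) ≤ 8 * (25 * (L : ℝ) ^ 4) * (1136016 * (L : ℝ) ^ 4) * (5408 * (6 * (L : ℝ) ^ 4) * (L : ℝ) ^ 6) := by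
      rw [hA]; gcongr
    have e1 : 8 * (25 * (L : ℝ) ^ 4) * (1136016 * (L : ℝ) ^ 4) * (5408 * (6 * (L : ℝ) ^ 4) * (L : ℝ) ^ 6) = 7372289433600 * (L : ℝ) ^ 18 := by ring
    rw [eG]; linarith
  · -- the tail budget
    have e1 : 2 * (4 * (9 * (L : ℝ) ^ 4 + 1) + (6 + lg + 18 * (L : ℝ) ^ 4 + 719712 * (L : ℝ) ^ 8)) =
        108 * (L : ℝ) ^ 4 + 20 + 2 * lg + 1439424 * (L : ℝ) ^ 8 := by ring
    rw [e1, eG]; linarith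

/-! ## §3 ★★★ `stub_h001_good` closed by name -/

set_option maxHeartbeats 800000 in
/-- ★★★ **(S-001-good) CLOSED: THE GOOD SIGN PATTERNS OF SECTOR 001 ARE CHART-MEASURE STIFF WITH PLAIN `κ_L`** — `stub_h001_good` of skeleton ➎ VERBATIM:
`∃ K > 0, ∃ q, ∀ L b, K·L^q ≤ b → ∀ ε, GoodSign ε → (9L⁴ − 3∕2 + 1∕8)·∫ e^{−bF̂₁(a,ε,η)} d(chartMeasure L) ≤ b·∫ F̂₁e^{−bF̂₁} d(chartMeasure L)`
(`K = (60000·290·C⁵)⁴`, `C = 8·10¹⁵ + 12|log(coneConst³∕64)|`, `q = 376`; ✓`tr_stiff` in the letters `(δ, η)` with the thresholds of §2 through g48's generic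
✓`bTube_threshold_arith` ∕ ✓`bTube_habs`, read back on `chartMeasure L` by §1). [cite: Luscher1983, §2] [cite: Griffiths1964] -/
theorem h001_good : ∃ K : ℝ, 0 < K ∧ ∃ q : ℕ, ∀ (L : ℕ) [NeZero L] (b : ℝ), K * (L : ℝ) ^ q ≤ b → ∀ ε : GnoSign L, GoodSign ε →
    (9 * (L : ℝ) ^ 4 - 3 / 2 + 1 / 8) * ∫ x, Real.exp (-(b * trGnoDeficit uJ z₁ (sectorChar z₁) x.1 ε x.2)) ∂chartMeasure L ≤
      b * ∫ x, trGnoDeficit uJ z₁ (sectorChar z₁) x.1 ε x.2 * Real.exp (-(b * trGnoDeficit uJ z₁ (sectorChar z₁) x.1 ε x.2)) ∂chartMeasure L := by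
  refine ⟨(60000 * 290 * (8000000000000000 + 12 * |Real.log (coneConst ^ 3 / 64)|) ^ 5) ^ 4, by positivity, 376, ?_⟩
  intro L _ b hb ε hε
  obtain ⟨R, G, hR0, hR1, hsmall, hDR, hG1, hlamG, hm8G, hAG, hRG, hBrG, hGle⟩ := tr_threshold_data (L := L)
  have hL1 : (1 : ℝ) ≤ L := by exact_mod_cast NeZero.one_le
  have hL0 : (0 : ℝ) < L := by linarith
  have hL4 : (1 : ℝ) ≤ (L : ℝ) ^ 4 := one_le_pow₀ hL1
  set lg : ℝ := |Real.log (coneConst ^ 3 / 64)| with hlg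
  have hlg0 : 0 ≤ lg := abs_nonneg _
  set c : ℝ := 1 + (Fintype.card (Fol L) : ℝ) with hcdef
  have hc1 : (1 : ℝ) ≤ c := by have : (0 : ℝ) ≤ Fintype.card (Fol L) := Nat.cast_nonneg _; rw [hcdef]; linarith
  set lam : ℝ := (5408 * c * (L : ℝ) ^ 6)⁻¹ with hlam
  have hlam0 : 0 < lam := by positivity
  have hm80 : (0 : ℝ) < (finrank ℝ (GnoFibreB L) : ℝ) + 8 := by positivity
  have hG0 : 0 < G := by linarith
  -- the threshold `(60000 L⁴ (290 G⁵))⁴ ≤ K·L^376 ≤ b`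
  have hGpow : (60000 * (L : ℝ) ^ 4 * (290 * G ^ 5)) ^ 4 ≤ b := by
    have h1 : G ^ 5 ≤ ((8000000000000000 + 12 * lg) * (L : ℝ) ^ 18) ^ 5 := pow_le_pow_left₀ hG0.le hGle 5
    have h2 : 60000 * (L : ℝ) ^ 4 * (290 * G ^ 5) ≤ 60000 * (L : ℝ) ^ 4 * (290 * ((8000000000000000 + 12 * lg) * (L : ℝ) ^ 18) ^ 5) := by gcongr
    have h3 : (60000 * (L : ℝ) ^ 4 * (290 * G ^ 5)) ^ 4 ≤ (60000 * (L : ℝ) ^ 4 * (290 * ((8000000000000000 + 12 * lg) * (L : ℝ) ^ 18) ^ 5)) ^ 4 :=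
      pow_le_pow_left₀ (by positivity) h2 4
    have e : (60000 * (L : ℝ) ^ 4 * (290 * ((8000000000000000 + 12 * lg) * (L : ℝ) ^ 18) ^ 5)) ^ 4 =
        (60000 * 290 * (8000000000000000 + 12 * lg) ^ 5) ^ 4 * (L : ℝ) ^ 376 := by ring
    rw [e] at h3
    exact h3.trans hb
  obtain ⟨hb1, hrate, htail⟩ := bTube_threshold_arith (L4 := (L : ℝ) ^ 4) (lam := lam) (m8 := (finrank ℝ (GnoFibreB L) : ℝ) + 8)
    (A := 1136016 * (L : ℝ) ^ 4) (R := R) (Br := 2 * (4 * (9 * (L : ℝ) ^ 4 + 1) + (6 + lg + 18 * (L : ℝ) ^ 4 + 719712 * (L : ℝ) ^ 8))) (G := G) (b := b)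
    hL4 hG1 hlam0 hlamG hm80 hm8G (by positivity) hAG hR0 hR1 hRG hBrG hGpow
  -- the tail absorption at `t ∈ [b, 2b]`
  have habs : ∀ t : ℝ, b ≤ t → t ≤ 2 * b →
      Real.exp (-(t * (R ^ 2 / (10816 * c * (L : ℝ) ^ 6)))) * (Real.pi * Real.exp (lg + 18 * (L : ℝ) ^ 4)) ≤
        t ^ (-(1 / 4 : ℝ)) * ((2 * Real.pi / t) ^ ((finrank ℝ (GnoFibreB L) : ℝ) / 2) * ((1 / 4) / Real.sqrt ((39984 * (L : ℝ) ^ 4) ^ finrank ℝ (GnoFibreB L)))) := by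
    intro t hbt _
    have ht1 : 1 ≤ t := hb1.trans hbt
    have ht0 : 0 < t := by linarith
    have hX := htail t hbt
    have e : t * (lam * R ^ 2) = 2 * (t * (R ^ 2 / (10816 * c * (L : ℝ) ^ 6))) := by rw [hlam]; field_simp; ring
    rw [e] at hX
    have hX' : t ^ (1 / 4 : ℝ) * (4 * (9 * (L : ℝ) ^ 4 + 1) + (6 + lg + 18 * (L : ℝ) ^ 4 + 719712 * (L : ℝ) ^ 8)) ≤ t * (R ^ 2 / (10816 * c * (L : ℝ) ^ 6)) := by
      nlinarith [Real.rpow_nonneg ht0.le (1 / 4 : ℝ)]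
    have h := bTube_habs (L := L) (lamR2 := R ^ 2 / (10816 * c * (L : ℝ) ^ 6)) ht1 hX'
    refine h.trans (mul_le_mul_of_nonneg_left (mul_le_mul_of_nonneg_left ?_ (Real.rpow_pos_of_pos (by positivity) _).le) (Real.rpow_nonneg ht0.le _))
    exact div_le_div_of_nonneg_right (by norm_num) (Real.sqrt_nonneg _)
  have hst := tr_stiff (L := L) ε hε.1 hε.2 hR0 hR1 hsmall hDR hb1 hrate habs
  -- read back on `chartMeasure L`
  rw [integral_tr_exp_eq_hubCot, integral_tr_action_eq_hubCot]
  have hκ : stiffKappa L (1 / 8) = 9 * (L : ℝ) ^ 4 - 3 / 2 + 1 / 8 := rfl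
  rw [← hκ]
  have hcπ : 0 < coneConst * Real.pi := mul_pos coneConst_pos Real.pi_pos
  have h := mul_le_mul_of_nonneg_left hst hcπ.le
  calc stiffKappa L (1 / 8) * (coneConst * Real.pi *
          ∫ p, Real.exp (-(b * trGnoDeficit uJ z₁ (sectorChar z₁) (hubAt p.1 1) ε p.2))
            ∂((volume : Measure (ℝ × GnoCoord L)).withDensity fun p => ENNReal.ofReal (((1 + p.1 ^ 2)⁻¹) ^ 2 * gnoDensity p.2)))
        = coneConst * Real.pi * (stiffKappa L (1 / 8) *
          ∫ p, Real.exp (-(b * trGnoDeficit uJ z₁ (sectorChar z₁) (hubAt p.1 1) ε p.2))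
            ∂((volume : Measure (ℝ × GnoCoord L)).withDensity fun p => ENNReal.ofReal (((1 + p.1 ^ 2)⁻¹) ^ 2 * gnoDensity p.2))) := by ring
    _ ≤ coneConst * Real.pi * (b * ∫ p, trGnoDeficit uJ z₁ (sectorChar z₁) (hubAt p.1 1) ε p.2 *
          Real.exp (-(b * trGnoDeficit uJ z₁ (sectorChar z₁) (hubAt p.1 1) ε p.2))
            ∂((volume : Measure (ℝ × GnoCoord L)).withDensity fun p => ENNReal.ofReal (((1 + p.1 ^ 2)⁻¹) ^ 2 * gnoDensity p.2))) := h
    _ = _ := by ring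

end Summit.QuantumFields.YangMills.Theorems.SwapVirialDeficit.SectorLaplace

end
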